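import Mathlib

/-!
# Arithmetic of the atoms trichotomy theorem (3/4 step)

Crux `Summit.MatrixMultiplication.MatrixMultiplication.Theses.SnSubsetDichotomy.PolynomialSlack`
(item `stmt-MatrixMultiplication-8306`), level-one programme, line transport-split-hull (lead c10).
Pure real-variable lemmas for the assembly `volume_le_of_atoms_trichotomy`:

* `atomsTrichotomy_params` — the facts about the explicit parameters
  `ε₂ = 1/(1000Λ)`, `ε₁ = τ/(10⁵ Λ G m)`, `h₁ = τ/(10⁴ Λ m²)`, `M = 10⁴ Λ m²/τ`,
  `A₀ = 5000 n G (LK + log (4/ε₂))/ε₂²`, `A₁ = n^{1.245}`, `P = A₀² n^{-1.51}/ε₁²` and the win bound `W`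
  that the per-row machinery (`rows_kept_le`) consumes, for a co-density `K ≥ 1` with `log K ≤ LK`;
* `atomsTrichotomy_tau` — `0 < ε₂ ≤ 1`, `ε₂ Λ = 1/1000`, `0 < τ ≤ 1` for the explicit
  `εm, Φ₀, τ = 1/(400 Φ₀)`, and the hypothesis `300 τ Φ < 1` of `trichotomy_cover` (`Φ ≤ Φ₀`);
* `atomsTrichotomy_slop_le` — the summed slop of a family of `r ≤ Λ/τ` hub rows is `≤ 0.0035`;
* `atomsTrichotomy_endgame` — the final inequality chain: an almost fully kept mass
  `1 - δ ≤ 5/8 · COST + 0.018`, the certificate `COST · log n ≤ q log n + 5 + MASS · L₁ + 6` and the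
  rate box `0.245 · MASS ≤ COST` are incompatible for `q ≤ 3/2`, `L₁ ≤ log n/500`, `log n ≥ 2000`.
-/

namespace Summit.MatrixMultiplication.MatrixMultiplication.Theorems.PolynomialSlack

set_option linter.dupNamespace false

/-- **Parameter facts.** For `n ≥ 2`, `Λ ≥ 1`, `0 < τ ≤ 1`, `m ≥ 1`, a co-density `K ≥ 1` with
`log K ≤ LK = 3/2 log n + 5`, and the explicit parameters of the atoms trichotomy theorem, the
hypotheses of `rows_kept_le` on `ε₁, ε₂, h₁, P, M, A₀, A₁, W` hold (with `log (4K/ε₂) ≤ LK + log (4/ε₂)`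
feeding the `A₀`-threshold and the first summand of the win bound). [folklore] -/
theorem atomsTrichotomy_params {n : ℕ} (hn : 2 ≤ n) (B : ℕ)
    (Λ LK τ mR ε₁ ε₂ h₁ M A₀ A₁ P W K : ℝ) (hΛ : 1 ≤ Λ) (hτ0 : 0 < τ) (hτ1 : τ ≤ 1)
    (hmR1 : 1 ≤ mR) (hK1 : 1 ≤ K) (hKL : Real.log K ≤ LK)
    (hε₂ : ε₂ = 1 / (1000 * Λ)) (hLK : LK = 3 / 2 * Real.log n + 5)
    (hε₁ : ε₁ = τ / (10 ^ 5 * Λ * (1 + Real.log n) * mR)) (hh₁ : h₁ = τ / (10 ^ 4 * Λ * mR ^ 2))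
    (hM : M = 10 ^ 4 * Λ * mR ^ 2 / τ)
    (hA₀ : A₀ = 5000 * n * (1 + Real.log n) * (LK + Real.log (4 / ε₂)) / ε₂ ^ 2)
    (hA₁ : A₁ = (n : ℝ) ^ (1245 / 1000 : ℝ))
    (hP : P = A₀ ^ 2 * (n : ℝ) ^ (-(151 / 100 : ℝ)) / ε₁ ^ 2)
    (hWdef : W = 10 ^ 7 * (1 + Real.log n) ^ 2 * (LK + Real.log (4 / ε₂)) ^ 2 * n * B /
          (ε₂ ^ 4 * h₁ ^ 2) +
        20 * (1 + M) * A₀ ^ 2 * B / (h₁ ^ 2 * n) + n * P * B +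
        20 * (1 + M) * A₁ ^ 2 * B / (h₁ ^ 2 * n)) :
    0 < ε₁ ∧ ε₁ ≤ 1 ∧ 0 < ε₂ ∧ ε₂ ≤ 1 ∧ 0 < h₁ ∧ 0 ≤ P ∧ 56 * (mR * mR) ≤ M ∧
    5000 * n * (1 + Real.log n) * Real.log (4 * K / ε₂) / ε₂ ^ 2 ≤ A₀ ∧ (n : ℝ) ≤ A₀ ∧
    124 / 100 * Real.log n ≤ Real.log A₁ ∧ A₀ ^ 2 * (n : ℝ) ^ (-(151 / 100 : ℝ)) ≤ P * ε₁ ^ 2 ∧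
    10 ^ 7 * (1 + Real.log n) ^ 2 * (Real.log (4 * K / ε₂)) ^ 2 * n * B / (ε₂ ^ 4 * h₁ ^ 2) +
        20 * (1 + M) * A₀ ^ 2 * B / (h₁ ^ 2 * n) + n * P * B +
        20 * (1 + M) * A₁ ^ 2 * B / (h₁ ^ 2 * n) ≤ W := by
  have hn0 : (0 : ℝ) < n := by exact_mod_cast (by omega : 0 < n)
  have hn1 : (1 : ℝ) ≤ n := by exact_mod_cast (by omega : 1 ≤ n)
  have hlog : 0 ≤ Real.log n := Real.log_nonneg hn1
  have hG1 : 1 ≤ 1 + Real.log n := by linarith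
  have hΛ0 : 0 < Λ := by linarith
  have hmR0 : 0 < mR := by linarith
  have hB0 : (0 : ℝ) ≤ B := Nat.cast_nonneg _
  -- `ε₂`
  have hε₂0 : 0 < ε₂ := by rw [hε₂]; positivity
  have hε₂1 : ε₂ ≤ 1 := by
    rw [hε₂, div_le_one (by positivity)]
    linarith
  -- `ε₁`
  have hε₁0 : 0 < ε₁ := by rw [hε₁]; positivity
  have hε₁1 : ε₁ ≤ 1 := by
    rw [hε₁, div_le_one (by positivity)]
    have h1 : (1 : ℝ) ≤ 10 ^ 5 * Λ := by linarith
    have h2 : (1 : ℝ) ≤ 10 ^ 5 * Λ * (1 + Real.log n) := one_le_mul_of_one_le_of_one_le h1 hG1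
    have h3 : (1 : ℝ) ≤ 10 ^ 5 * Λ * (1 + Real.log n) * mR := one_le_mul_of_one_le_of_one_le h2 hmR1
    linarith
  -- `h₁`, `P`
  have hh₁0 : 0 < h₁ := by rw [hh₁]; positivity
  have hP0 : 0 ≤ P := by
    rw [hP]
    have : 0 ≤ (n : ℝ) ^ (-(151 / 100 : ℝ)) := Real.rpow_nonneg hn0.le _
    positivity
  -- `M ≥ 56 m²`
  have hMge : 56 * (mR * mR) ≤ M := by
    rw [hM, le_div_iff₀ hτ0]
    have h1 : mR * mR * τ ≤ mR * mR * 1 := mul_le_mul_of_nonneg_left hτ1 (by positivity)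
    have h2 : mR * mR ≤ Λ * (mR * mR) := le_mul_of_one_le_left (by positivity) hΛ
    have h3 : 0 ≤ Λ * (mR * mR) := by positivity
    nlinarith
  -- `log (4K/ε₂) = log K + log (4/ε₂) ≤ LK + log (4/ε₂)`, and it is nonnegative
  have h4e : 1 ≤ 4 / ε₂ := by
    rw [le_div_iff₀ hε₂0]
    linarith
  have hlog4e : 0 ≤ Real.log (4 / ε₂) := Real.log_nonneg h4e
  have hK0 : 0 < K := by linarith
  have hlogK0 : 0 ≤ Real.log K := Real.log_nonneg hK1
  have hLA : Real.log (4 * K / ε₂) = Real.log K + Real.log (4 / ε₂) := by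
    rw [show 4 * K / ε₂ = K * (4 / ε₂) by ring, Real.log_mul hK0.ne' (by positivity)]
  have hLA0 : 0 ≤ Real.log (4 * K / ε₂) := by rw [hLA]; exact add_nonneg hlogK0 hlog4e
  have hLAle : Real.log (4 * K / ε₂) ≤ LK + Real.log (4 / ε₂) := by rw [hLA]; linarith
  have hLK5 : 5 ≤ LK := by rw [hLK]; linarith
  -- `A₀`
  have hA₀K : 5000 * n * (1 + Real.log n) * Real.log (4 * K / ε₂) / ε₂ ^ 2 ≤ A₀ := by
    rw [hA₀]
    exact div_le_div_of_nonneg_right (mul_le_mul_of_nonneg_left hLAle (by positivity))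
      (by positivity)
  have hA₀n : (n : ℝ) ≤ A₀ := by
    rw [hA₀, le_div_iff₀ (by positivity)]
    have h1 : ε₂ ^ 2 ≤ 1 := pow_le_one₀ hε₂0.le hε₂1
    have h2 : (1 : ℝ) * 5 ≤ (1 + Real.log n) * (LK + Real.log (4 / ε₂)) :=
      mul_le_mul hG1 (by linarith) (by norm_num) (by linarith)
    have h3 : (n : ℝ) * ε₂ ^ 2 ≤ n * 1 := mul_le_mul_of_nonneg_left h1 hn0.le
    have h4 : (n : ℝ) * 1 ≤ n * (5000 * ((1 + Real.log n) * (LK + Real.log (4 / ε₂)))) :=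
      mul_le_mul_of_nonneg_left (by linarith) hn0.le
    calc (n : ℝ) * ε₂ ^ 2 ≤ n * (5000 * ((1 + Real.log n) * (LK + Real.log (4 / ε₂)))) :=
          h3.trans h4
      _ = 5000 * n * (1 + Real.log n) * (LK + Real.log (4 / ε₂)) := by ring
  -- `A₁`, `P ε₁²`
  have hA₁log : 124 / 100 * Real.log n ≤ Real.log A₁ := by
    rw [hA₁, Real.log_rpow hn0]
    linarith
  have hPlow : A₀ ^ 2 * (n : ℝ) ^ (-(151 / 100 : ℝ)) ≤ P * ε₁ ^ 2 := by
    rw [hP, div_mul_cancel₀ _ (pow_ne_zero 2 hε₁0.ne')]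
  -- the win bound
  have hW : 10 ^ 7 * (1 + Real.log n) ^ 2 * (Real.log (4 * K / ε₂)) ^ 2 * n * B / (ε₂ ^ 4 * h₁ ^ 2) +
      20 * (1 + M) * A₀ ^ 2 * B / (h₁ ^ 2 * n) + n * P * B +
      20 * (1 + M) * A₁ ^ 2 * B / (h₁ ^ 2 * n) ≤ W := by
    rw [hWdef]
    have hsq : (Real.log (4 * K / ε₂)) ^ 2 ≤ (LK + Real.log (4 / ε₂)) ^ 2 :=
      pow_le_pow_left₀ hLA0 hLAle 2
    have hfac : (0 : ℝ) ≤ 10 ^ 7 * (1 + Real.log n) ^ 2 := by positivity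
    have h1 : 10 ^ 7 * (1 + Real.log n) ^ 2 * (Real.log (4 * K / ε₂)) ^ 2 * n * B /
        (ε₂ ^ 4 * h₁ ^ 2) ≤
        10 ^ 7 * (1 + Real.log n) ^ 2 * (LK + Real.log (4 / ε₂)) ^ 2 * n * B / (ε₂ ^ 4 * h₁ ^ 2) :=
      div_le_div_of_nonneg_right (mul_le_mul_of_nonneg_right (mul_le_mul_of_nonneg_right
        (mul_le_mul_of_nonneg_left hsq hfac) hn0.le) hB0) (by positivity)
    linarith
  exact ⟨hε₁0, hε₁1, hε₂0, hε₂1, hh₁0, hP0, hMge, hA₀K, hA₀n, hA₁log, hPlow, hW⟩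

/-- **Cover parameters.** For `n ≥ 2`, `Λ ≥ 1` and the explicit `ε₂ = 1/(1000Λ)`,
`εm = ε₂²/(12G(2 + log(1/ε₂)))`, `LK = 3/2 log n + 5`, `Φ₀ = 576 G · 2(log 8 + LK + log(1/εm))/εm³`,
`τ = 1/(400Φ₀)`: `0 < ε₂ ≤ 1`, `ε₂Λ = 1/1000`, `0 < τ ≤ 1`, and for two co-densities `K, K' ≥ 1` with
`log K, log K' ≤ LK` the `ε₂`-matching bound `Φ` of `trichotomy_cover` satisfies `300 τ Φ < 1`
(as `log (8K/εm) = log 8 + log K + log (1/εm)` gives `Φ ≤ Φ₀`). [folklore] -/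
theorem atomsTrichotomy_tau {n : ℕ} (hn : 2 ≤ n) (Λ LK ε₂ εm Φ₀ τ K K' : ℝ) (hΛ : 1 ≤ Λ)
    (hε₂ : ε₂ = 1 / (1000 * Λ))
    (hεm : εm = ε₂ ^ 2 / (12 * (1 + Real.log n) * (2 + Real.log (1 / ε₂))))
    (hLK : LK = 3 / 2 * Real.log n + 5)
    (hΦ₀ : Φ₀ = 576 * (1 + Real.log n) * (2 * (Real.log 8 + LK + Real.log (1 / εm))) / εm ^ 3)
    (hτ : τ = 1 / (400 * Φ₀)) (hK : 1 ≤ K) (hKL : Real.log K ≤ LK) (hK' : 1 ≤ K')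
    (hKL' : Real.log K' ≤ LK) :
    0 < ε₂ ∧ ε₂ ≤ 1 ∧ ε₂ * Λ = 1 / 1000 ∧ 0 < τ ∧ τ ≤ 1 ∧
    300 * τ * (576 * (1 + Real.log n) *
      (Real.log (8 * K / (ε₂ ^ 2 / (12 * (1 + Real.log n) * (2 + Real.log (1 / ε₂))))) +
        Real.log (8 * K' / (ε₂ ^ 2 / (12 * (1 + Real.log n) * (2 + Real.log (1 / ε₂)))))) /
      (ε₂ ^ 2 / (12 * (1 + Real.log n) * (2 + Real.log (1 / ε₂)))) ^ 3) < 1 := by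
  have hn1 : (1 : ℝ) ≤ n := by exact_mod_cast (by omega : 1 ≤ n)
  have hlog1 : 0 ≤ Real.log n := Real.log_nonneg hn1
  have hG1 : 1 ≤ 1 + Real.log n := by linarith
  have hΛ0 : 0 < Λ := by linarith
  -- `ε₂`
  have hε₂0 : 0 < ε₂ := by rw [hε₂]; positivity
  have hε₂Λ : ε₂ * Λ = 1 / 1000 := by
    rw [hε₂]
    field_simp
  have hε₂1 : ε₂ ≤ 1 / 1000 := by
    rw [hε₂]
    exact one_div_le_one_div_of_le (by norm_num) (by linarith)
  have hle₂ : 0 ≤ Real.log (1 / ε₂) :=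
    Real.log_nonneg (by rw [le_div_iff₀ hε₂0]; linarith)
  -- `εm ∈ (0, 1]`
  have hden : 0 < 12 * (1 + Real.log n) * (2 + Real.log (1 / ε₂)) :=
    mul_pos (mul_pos (by norm_num) (by linarith)) (by linarith)
  have hεm0 : 0 < εm := by rw [hεm]; exact div_pos (pow_pos hε₂0 2) hden
  have hεm1 : εm ≤ 1 := by
    rw [hεm, div_le_one hden]
    have h1 : ε₂ ^ 2 ≤ 1 := pow_le_one₀ hε₂0.le (by linarith)
    have h2 : (1 : ℝ) * 2 ≤ (1 + Real.log n) * (2 + Real.log (1 / ε₂)) :=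
      mul_le_mul hG1 (by linarith) (by norm_num) (by linarith)
    linarith
  have hlem : 0 ≤ Real.log (1 / εm) :=
    Real.log_nonneg (by rw [le_div_iff₀ hεm0]; linarith)
  -- `Φ₀ ≥ 1`, `τ ∈ (0, 1]`
  have hLK5 : 5 ≤ LK := by rw [hLK]; linarith
  have hl8 : 0 < Real.log 8 := Real.log_pos (by norm_num)
  have hΦ₀1 : 1 ≤ Φ₀ := by
    rw [hΦ₀, le_div_iff₀ (pow_pos hεm0 3), one_mul]
    have h1 : εm ^ 3 ≤ 1 := pow_le_one₀ hεm0.le hεm1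
    have h2 : (1 : ℝ) * 5 ≤ (1 + Real.log n) * (Real.log 8 + LK + Real.log (1 / εm)) :=
      mul_le_mul hG1 (by linarith) (by norm_num) (by linarith)
    linarith
  have hτ0 : 0 < τ := by rw [hτ]; exact div_pos one_pos (by linarith)
  have hτ1 : τ ≤ 1 := by
    rw [hτ, div_le_one (by linarith)]
    linarith
  -- `Φ ≤ Φ₀`, so `300 τ Φ ≤ 300 τ Φ₀ = 3/4 < 1`
  have hsplit : ∀ L : ℝ, 1 ≤ L → Real.log L ≤ LK →
      Real.log (8 * L / εm) ≤ Real.log 8 + LK + Real.log (1 / εm) := by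
    intro L hL hLL
    have hL0 : 0 < L := by linarith
    rw [show 8 * L / εm = 8 * L * (1 / εm) by ring,
      Real.log_mul (mul_pos (by norm_num) hL0).ne' (one_div_pos.2 hεm0).ne',
      Real.log_mul (by norm_num) hL0.ne']
    linarith
  have hΦ : 576 * (1 + Real.log n) * (Real.log (8 * K / εm) + Real.log (8 * K' / εm)) / εm ^ 3 ≤
      Φ₀ := by
    rw [hΦ₀]
    refine div_le_div_of_nonneg_right (mul_le_mul_of_nonneg_left ?_ (by positivity))
      (pow_pos hεm0 3).le
    linarith [hsplit K hK hKL, hsplit K' hK' hKL']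
  have hτΦ : 300 * τ * (576 * (1 + Real.log n) *
      (Real.log (8 * K / εm) + Real.log (8 * K' / εm)) / εm ^ 3) < 1 := by
    have hΦ₀0 : 0 < Φ₀ := by linarith
    calc _ ≤ 300 * τ * Φ₀ := mul_le_mul_of_nonneg_left hΦ (by positivity)
      _ = 3 / 4 := by
          rw [hτ]
          field_simp
          norm_num
      _ < 1 := by norm_num
  rw [hεm] at hτΦ
  exact ⟨hε₂0, by linarith, hε₂Λ, hτ0, hτ1, hτΦ⟩

/-- **Slop budget.** With `ε₂ = 1/(1000Λ)`, `ε₁ = τ/(10⁵ΛGm)`, `h₁ = τ/(10⁴Λm²)`, `M = 10⁴Λm²/τ`,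
`0 < τ ≤ 1 ≤ Λ, G, m`, `2000 Λ ≤ n` and `r τ ≤ Λ` hub rows, the summed slop of `rows_kept_le` is
`(2ε₂ + 5Gε₁ + 1/n)Λ + r(4ε₁m + 4m²h₁ + 4m²/M + 5Gε₁) ≤ 0.0035`. [folklore] -/
theorem atomsTrichotomy_slop_le {Λ G m τ ε₁ ε₂ h₁ M nR r : ℝ} (hΛ : 1 ≤ Λ) (hG : 1 ≤ G)
    (hm : 1 ≤ m) (hτ0 : 0 < τ) (hτ1 : τ ≤ 1) (hε₂ : ε₂ = 1 / (1000 * Λ))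
    (hε₁ : ε₁ = τ / (10 ^ 5 * Λ * G * m)) (hh₁ : h₁ = τ / (10 ^ 4 * Λ * m ^ 2))
    (hM : M = 10 ^ 4 * Λ * m ^ 2 / τ) (hn : 2000 * Λ ≤ nR) (hr0 : 0 ≤ r) (hr : r * τ ≤ Λ) :
    (2 * ε₂ + 5 * G * ε₁ + 1 / nR) * Λ +
        r * (4 * ε₁ * m + 4 * (m * m) * h₁ + 4 * (m * m) / M + 5 * G * ε₁) ≤ 35 / 10000 := by
  have hΛ0 : 0 < Λ := by linarith
  have hG0 : 0 < G := by linarith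
  have hm0 : 0 < m := by linarith
  have hn0 : 0 < nR := by nlinarith
  have hΛne : Λ ≠ 0 := hΛ0.ne'
  have hGne : G ≠ 0 := hG0.ne'
  have hmne : m ≠ 0 := hm0.ne'
  have hτne : τ ≠ 0 := hτ0.ne'
  have hnne : nR ≠ 0 := hn0.ne'
  have hs0 : 0 ≤ r * τ := mul_nonneg hr0 hτ0.le
  have e : (2 * ε₂ + 5 * G * ε₁ + 1 / nR) * Λ +
      r * (4 * ε₁ * m + 4 * (m * m) * h₁ + 4 * (m * m) / M + 5 * G * ε₁) =
      2 / 1000 + 5 * τ / (10 ^ 5 * m) + Λ / nR + (4 * (r * τ) / (10 ^ 5 * Λ * G) +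
        4 * (r * τ) / (10 ^ 4 * Λ) + 4 * (r * τ) / (10 ^ 4 * Λ) + 5 * (r * τ) / (10 ^ 5 * Λ * m)) := by
    rw [hε₂, hε₁, hh₁, hM]
    field_simp
  have b1 : 5 * τ / (10 ^ 5 * m) ≤ 5 / 10 ^ 5 := by
    rw [div_le_div_iff₀ (by positivity) (by norm_num)]
    nlinarith
  have b2 : Λ / nR ≤ 1 / 2000 := by
    rw [div_le_div_iff₀ hn0 (by norm_num)]
    linarith
  have hΛG : Λ ≤ Λ * G := le_mul_of_one_le_right hΛ0.le hG
  have hΛm : Λ ≤ Λ * m := le_mul_of_one_le_right hΛ0.le hm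
  have b3 : 4 * (r * τ) / (10 ^ 5 * Λ * G) ≤ 4 / 10 ^ 5 := by
    rw [div_le_div_iff₀ (by positivity) (by norm_num)]
    nlinarith
  have b4 : 4 * (r * τ) / (10 ^ 4 * Λ) ≤ 4 / 10 ^ 4 := by
    rw [div_le_div_iff₀ (by positivity) (by norm_num)]
    nlinarith
  have b5 : 5 * (r * τ) / (10 ^ 5 * Λ * m) ≤ 5 / 10 ^ 5 := by
    rw [div_le_div_iff₀ (by positivity) (by norm_num)]
    nlinarith
  rw [e]
  norm_num at b1 b3 b4 b5 ⊢
  linarith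

/-- **The endgame.** `Lg = log n ≥ 2000`; the kept inequality `1 - δ ≤ KEPT`, the cover
`KEPT ≤ ROWS + COLS + 1/100 + ε₂Λ` (`ε₂Λ = 1/1000`), the two halves
`ROWS + COLS ≤ 5/8 COST + slops` (slops `≤ 0.0035` each), the rate box `0.245 MASS ≤ COST`, the
certificate `COST · Lg ≤ (log K_A + log K_B + log K_C) + MASS · L₁ + 6` with the co-density cap
`≤ q Lg + 5`, `q ≤ 3/2`, and `0 ≤ L₁ ≤ Lg/500` are contradictory. [folklore] -/
theorem atomsTrichotomy_endgame {Lg q δ KEPT ROWS COLS COST MASS LKs L₁ sR sQ eΛ : ℝ}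
    (hLg : 2000 ≤ Lg) (hq : q ≤ 3 / 2) (hδ : δ ≤ 1 / 1000) (hkept : 1 - δ ≤ KEPT)
    (hcover : KEPT ≤ ROWS + COLS + (1 / 100 + eΛ)) (heΛ : eΛ = 1 / 1000)
    (hhalves : ROWS + COLS ≤ 5 / 8 * COST + (sR + sQ)) (hsR : sR ≤ 35 / 10000)
    (hsQ : sQ ≤ 35 / 10000) (hrate : 245 / 1000 * MASS ≤ COST)
    (hcert : COST * Lg ≤ LKs + (MASS * L₁ + 6)) (hQ : LKs ≤ q * Lg + 5)
    (hL₁0 : 0 ≤ L₁) (hL₁ : L₁ ≤ Lg / 500) : False := by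
  have hLg0 : 0 ≤ Lg := by linarith
  have hC : 981 / 1000 ≤ 5 / 8 * COST := by linarith
  have hC0 : 0 ≤ COST := by linarith
  have hqL : q * Lg ≤ 3 / 2 * Lg := mul_le_mul_of_nonneg_right hq hLg0
  have h1 : 245 / 1000 * MASS * L₁ ≤ COST * L₁ := mul_le_mul_of_nonneg_right hrate hL₁0
  have h2 : COST * L₁ ≤ COST * (Lg / 500) := mul_le_mul_of_nonneg_left hL₁ hC0
  have h3 : COST * Lg * (243 / 245) ≤ 3 / 2 * Lg + 11 := by linarith
  have h4 : 981 / 1000 * Lg ≤ 5 / 8 * COST * Lg := mul_le_mul_of_nonneg_right hC hLg0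
  linarith

end Summit.MatrixMultiplication.MatrixMultiplication.Theorems.PolynomialSlack
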